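import Summits.BirchSwinnertonDyer.BirchSwinnertonDyer.Theorems.SylvesterTwoHeegnerIndexTwoAdicPairOddIndex
import Summits.BirchSwinnertonDyer.BirchSwinnertonDyer.Theorems.SylvesterTwoHeegnerIndexCoupledDescentCebotarevKummerImage
import Summits.BirchSwinnertonDyer.BirchSwinnertonDyer.Theorems.SylvesterTwoHeegnerIndexFrameConstants
import Literature.NumberTheory.EllipticCurves.MordellCurveSqrtThreeEndomorphism
import Literature.NumberTheory.EllipticCurves.SelmerTorsionCMOperatorOddNormUnits
import Literature.NumberTheory.EllipticCurves.BSDRankZeroDensity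
import HarnessLib

/-!
# The COUPLED Cassels–Tate telescope, XLI: glue for the BOTTOM LINK of RESIDUE c v3 (crux `UpperOffV0HSYPlus`,
# stmt-BirchSwinnertonDyer-19804) — the `θ`-seam of the Kummer map, torsion classes, generators, a `2`-adic count

RESIDUE 4 v3 quantifies its bottom point `Y : B_K` ANONYMOUSLY (any point of the displayed height), so the rows'
`cB 1 = 2^{M₀} • δ(x₀) = δ(Y^tr)` differs from the Kolyvagin bottom class `m • δ(Y₁)` (HSY's named point) by a
`2`-ADIC unit of `𝒪 = ℤ[ω]` (planner D732 (i)–(iii)).  `…CoupledTelescopeBottomLink` compares the two inside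
an `𝒪`-stable local kernel; this file supplies its instance-free glue (`B₀ = (cubeSumCurve p) ⊗ K`):
* `toGeomPoints_omegaRot_omegaRot` — the display's `φ_B : (x, y) ↦ (ω² x, ω³ y)` is `θ ∘ θ` on `B₀(K)` for
  (T6)'s `θ = (x, y) ↦ (ω x, y)` (k-ty1 ON-CALL CHECK 1);  `omegaRot_omegaRot_omegaRot` — `θ³ = 1`;
* `kummerMapTorsion_omegaRot` — `δ(θ Q) = −δ Q − w_B (δ Q)` (Kummer naturality
  `resH1Hom_id_kummerMapTorsion` + `w_B² + w_B + 1 = 0`);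
* `kummerMapTorsion_eq_zero_of_isOfFinAddOrder` — `δ T = 0` at a `2`-power level for every torsion `T`
  (`B₀(K)` has no `2`-torsion, `two_torsion_eq_zero_cubeSumCurve_of_finrank_eq_two`);
* `canonicalHeight_incl_eq_of_generators` — two generators of `B(ℚ)` modulo torsion have the same height;
* `two_pow_exponent_eq` — `4^e · N · n₁² = 4^{e₁} · N₁ · n²` with `N, N₁, n, n₁` odd forces `e = e₁`.
Theorems only (no definition / named fact / instance / notation); nothing asserted on 19804; no stub closed;
X12.CMAtTwo NOT proved; BSD not claimed for any curve.  Sources: [GrossLMS1991] §4 (4.4), §5 (5.1);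
[SilvermanAEC2009] III.10.1, VIII.§2; [HuShuYin2019] §1 p. 4, §2 p. 8; [IrelandRosen1990] Ch. 9 §1.
`lean search 'kummerMapTorsion_omegaRot|two_pow_exponent_eq'` → nothing before this file.
-/

-- every Summits module is named `Summit.<Summit>.<Problem>…`: the duplicated component is by design
set_option linter.dupNamespace false
set_option autoImplicit false

noncomputable section

open scoped Classical

open WeierstrassCurve WeierstrassCurve.Affine WeierstrassCurve.Affine.Point NumberField IsDedekindDomain
  Literature.NumberTheory.EllipticCurves Literature.NumberTheory.EllipticCurves.HuShuYin2019
  Literature.NumberTheory.EllipticCurves.KolyvaginCocycle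

namespace Summit.BirchSwinnertonDyer.BirchSwinnertonDyer.Theorems.SylvesterTwoCoupledTelescope

open Summit.BirchSwinnertonDyer.BirchSwinnertonDyer.Theorems.SylvesterTwoCMNormForm
  Summit.BirchSwinnertonDyer.BirchSwinnertonDyer.Theorems.SylvesterTwoCoupledDescentCebotarev
  Summit.BirchSwinnertonDyer.BirchSwinnertonDyer.Theorems.SylvesterTwoFrame

variable {K : Type} [Field K] [NumberField K]

omit [NumberField K] in
/-- **The display's `φ_B = (x, y) ↦ (ω² x, ω³ y)` is `θ ∘ θ` on `K`-points**, `θ = (x, y) ↦ (ω x, y)` ((T6)'s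
`omegaRot`): `φ_B (ι Q) = ι (θ (θ Q))` (`ω³ = 1`). [cite: HuShuYin2019, §1 p. 4 ([ω](x,y) = (ωx, y))]
[cite: SilvermanAEC2009, III.10.1] -/
theorem toGeomPoints_omegaRot_omegaRot {ω : K} (hω : ω ^ 2 + ω + 1 = 0) {W : WeierstrassCurve K}
    (h1 : W.a₁ = 0) (h2 : W.a₂ = 0) (h3 : W.a₃ = 0) (h4 : W.a₄ = 0)
    (φ : geomPoints W →+ geomPoints W)
    (hφ : ∀ (x y : AlgebraicClosure K) (h : (W.baseChange (AlgebraicClosure K)).toAffine.Nonsingular x y),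
      ∃ h', φ (Affine.Point.some x y h) =
        Affine.Point.some (algebraMap K (AlgebraicClosure K) ω ^ 2 * x) (algebraMap K (AlgebraicClosure K) ω ^ 3 * y) h')
    {θ : W.toAffine.Point → W.toAffine.Point} (hθ0 : θ 0 = 0)
    (hθ : ∀ (x y : K) (h : W.toAffine.Nonsingular x y), θ (.some x y h) = .some (ω * x) y (nonsingular_omega_mul hω h1 h2 h3 h4 h))
    (Q : W.toAffine.Point) : φ (toGeomPoints W Q) = toGeomPoints W (θ (θ Q)) := by
  rcases Q with _ | ⟨x, y, h⟩
  · change φ (toGeomPoints W 0) = toGeomPoints W (θ (θ 0))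
    rw [hθ0, hθ0, _root_.map_zero, _root_.map_zero]
  · rw [hθ, hθ]
    obtain ⟨h', e'⟩ := hφ (algebraMap K _ x) (algebraMap K _ y) (SqrtThree.nonsingular_algebraMap _ h)
    rw [SqrtThree.toGeomPoints_some' _ h (SqrtThree.nonsingular_algebraMap _ h) rfl rfl, e',
      SqrtThree.toGeomPoints_some' _ _ h' _ _]
    · rw [map_mul, map_mul, pow_two, mul_assoc]
    · rw [← map_pow, omega_pow_three hω, map_one, one_mul]

omit [NumberField K] in
/-- **`θ³ = 1`** for `θ = (x, y) ↦ (ω x, y)` (`ω³ = 1`). [cite: SilvermanAEC2009, III.10.1] -/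
theorem omegaRot_omegaRot_omegaRot {ω : K} (hω : ω ^ 2 + ω + 1 = 0) {W : WeierstrassCurve K}
    (h1 : W.a₁ = 0) (h2 : W.a₂ = 0) (h3 : W.a₃ = 0) (h4 : W.a₄ = 0)
    {θ : W.toAffine.Point → W.toAffine.Point} (hθ0 : θ 0 = 0)
    (hθ : ∀ (x y : K) (h : W.toAffine.Nonsingular x y), θ (.some x y h) = .some (ω * x) y (nonsingular_omega_mul hω h1 h2 h3 h4 h))
    (Q : W.toAffine.Point) : θ (θ (θ Q)) = Q := by
  rcases Q with _ | ⟨x, y, h⟩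
  · change θ (θ (θ 0)) = 0
    rw [hθ0, hθ0, hθ0]
  · rw [hθ, hθ, hθ]
    exact Affine.Point.some_eq_some_of_eq (by rw [← mul_assoc, ← mul_assoc, ← pow_three', omega_pow_three hω, one_mul]) rfl

omit [NumberField K] in
/-- **`δ(θ Q) = −δ Q − w (δ Q)`** on `H¹(K, E[n])`, `w = H¹(fn)` for the display's `φ = θ²` restricting to `fn` on
`E[n]`: Kummer naturality (`resH1Hom_id_kummerMapTorsion`: `w (δ Q) = δ (θ² Q)`, `w (δ (θ² Q)) = δ (θ⁴ Q) = δ (θ Q)`)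
and `w² + w + 1 = 0`. [cite: GrossLMS1991, §5 (5.1)] [cite: SilvermanAEC2009, VIII.§2] -/
theorem kummerMapTorsion_omegaRot {ω : K} (hω : ω ^ 2 + ω + 1 = 0) {W : WeierstrassCurve K} [W.IsElliptic]
    (h1 : W.a₁ = 0) (h2 : W.a₂ = 0) (h3 : W.a₃ = 0) (h4 : W.a₄ = 0) (n : ℤ)
    (φ : geomPoints W →+ geomPoints W) (hφG : ∀ (g : Field.absoluteGaloisGroup K) (P : geomPoints W), φ (g • P) = g • φ P)
    (hφ : ∀ (x y : AlgebraicClosure K) (h : (W.baseChange (AlgebraicClosure K)).toAffine.Nonsingular x y),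
      ∃ h', φ (Affine.Point.some x y h) =
        Affine.Point.some (algebraMap K (AlgebraicClosure K) ω ^ 2 * x) (algebraMap K (AlgebraicClosure K) ω ^ 3 * y) h')
    (fn : geomTorsion W n →+ geomTorsion W n)
    (hfn : ∀ (g : Field.absoluteGaloisGroup K) (Q : geomTorsion W n), fn (ContinuousMonoidHom.id _ g • Q) = g • fn Q)
    (hcoe : ∀ Q : geomTorsion W n, ((fn Q : geomTorsion W n) : geomPoints W) = φ Q)
    (hrel : ∀ c, resH1Hom (ContinuousMonoidHom.id _) fn hfn (resH1Hom (ContinuousMonoidHom.id _) fn hfn c) +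
      resH1Hom (ContinuousMonoidHom.id _) fn hfn c + c = 0)
    (hdiv : ∀ P : geomPoints W, ∃ Q : geomPoints W, n • Q = P)
    {θ : W.toAffine.Point → W.toAffine.Point} (hθ0 : θ 0 = 0)
    (hθ : ∀ (x y : K) (h : W.toAffine.Nonsingular x y), θ (.some x y h) = .some (ω * x) y (nonsingular_omega_mul hω h1 h2 h3 h4 h))
    (Q : W.toAffine.Point) :
    kummerMapTorsion W n hdiv (θ Q) =
      -kummerMapTorsion W n hdiv Q - resH1Hom (ContinuousMonoidHom.id _) fn hfn (kummerMapTorsion W n hdiv Q) := by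
  have hnat : ∀ P : W.toAffine.Point, resH1Hom (ContinuousMonoidHom.id _) fn hfn (kummerMapTorsion W n hdiv P) =
      kummerMapTorsion W n hdiv (θ (θ P)) := fun P ↦
    resH1Hom_id_kummerMapTorsion W n φ hφG fn hfn hcoe hdiv P _
      (toGeomPoints_omegaRot_omegaRot hω h1 h2 h3 h4 φ hφ hθ0 hθ P)
  have h4Q : θ (θ (θ (θ Q))) = θ Q := by rw [omegaRot_omegaRot_omegaRot hω h1 h2 h3 h4 hθ0 hθ]
  have key := hrel (kummerMapTorsion W n hdiv Q)
  rw [hnat, hnat, h4Q] at key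
  rw [hnat, eq_sub_iff_add_eq, eq_neg_iff_add_eq_zero, ← key]

/-- **Torsion points have trivial Kummer class at a `2`-power level on `E_p ⊗ K`** (`K ∋ ω` quadratic, `p ≠ 2`
prime): `E_p(K)` has no `2`-torsion, so a torsion `T` has odd order `r`, `u r + v 2^M = 1` gives `T = 2^M • (v • T)`,
and `H¹(K, E[2^M])` is killed by `2^M`. [cite: HuShuYin2019, §2 p. 8 (E_p(K)_tors)] [cite: SilvermanAEC2009, VIII.§2] -/
theorem kummerMapTorsion_eq_zero_of_isOfFinAddOrder (h2K : Module.finrank ℚ K = 2) {p : ℕ} (hp : p.Prime)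
    (hp2 : p ≠ 2) {M : ℕ} (nl : ℕ) (hn : nl = 2 ^ M)
    (hdiv : ∀ P : geomPoints ((cubeSumCurve (p : ℚ)).baseChange K),
      ∃ Q : geomPoints ((cubeSumCurve (p : ℚ)).baseChange K), ((nl : ℕ) : ℤ) • Q = P)
    {T : ((cubeSumCurve (p : ℚ)).baseChange K).toAffine.Point} (hT : IsOfFinAddOrder T) :
    kummerMapTorsion ((cubeSumCurve (p : ℚ)).baseChange K) ((nl : ℕ) : ℤ) hdiv T = 0 := by
  subst hn
  -- the order `r` of `T` is odd
  have hr := hT.addOrderOf_pos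
  set r := addOrderOf T with hrdef
  have hrT : (r : ℤ) • T = 0 := by rw [natCast_zsmul, addOrderOf_nsmul_eq_zero]
  have hrodd : Odd r := by
    rcases Nat.even_or_odd r with ⟨k, hk⟩ | hodd
    · exfalso
      have hk0 : 0 < k := by omega
      have h2k : 2 • (k • T) = 0 := by
        rw [← mul_nsmul, show k * 2 = r by omega]; exact addOrderOf_nsmul_eq_zero T
      have hkT : k • T = 0 := two_torsion_eq_zero_cubeSumCurve_of_finrank_eq_two K h2K hp hp2 _ h2k
      have := addOrderOf_le_of_nsmul_eq_zero hk0 hkT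
      omega
    · exact hodd
  -- Bezout `u r + v 2^M = 1`, so `T = 2^M • (v • T)`
  obtain ⟨k, hk⟩ := hrodd
  have hcop : IsCoprime (r : ℤ) ((2 : ℤ) ^ M) := by
    have h2 : IsCoprime (r : ℤ) 2 := ⟨1, -(k : ℤ), by push_cast [hk]; ring⟩
    exact h2.pow_right
  obtain ⟨u, v, huv⟩ := hcop
  have hTe : T = (((2 ^ M : ℕ) : ℤ)) • (v • T) := by
    calc T = (u * r + v * 2 ^ M) • T := by rw [huv, one_smul]
      _ = u • ((r : ℤ) • T) + (((2 ^ M : ℕ) : ℤ)) • (v • T) := by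
          rw [add_smul, mul_smul, mul_comm v, mul_smul]; push_cast; rfl
      _ = (((2 ^ M : ℕ) : ℤ)) • (v • T) := by rw [hrT, smul_zero, zero_add]
  rw [hTe, map_zsmul]
  exact zsmul_galH1Torsion_eq_zero _ (((2 ^ M : ℕ) : ℤ)) _

/-- **Two generators of `B(ℚ)` modulo torsion have the same canonical height** (over `K`): `P₁ = ±P + torsion`.
[cite: SilvermanAEC2009, VIII.9.3] -/
theorem canonicalHeight_incl_eq_of_generators (B : WeierstrassCurve ℚ) [B.IsElliptic] {P P₁ : B.toAffine.Point}
    (hP : ¬ IsOfFinAddOrder (QuadraticDescent.incl K B P))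
    (hgen : ∀ Q : B.toAffine.Point, ∃ m : ℤ, IsOfFinAddOrder (QuadraticDescent.incl K B Q - m • QuadraticDescent.incl K B P))
    (hgen₁ : ∀ Q : B.toAffine.Point, ∃ m : ℤ, IsOfFinAddOrder (QuadraticDescent.incl K B Q - m • QuadraticDescent.incl K B P₁)) :
    canonicalHeight (QuadraticDescent.incl K B P₁) = canonicalHeight (QuadraticDescent.incl K B P) := by
  haveI : (B.baseChange K).IsElliptic := inferInstanceAs (B.map (algebraMap ℚ K)).IsElliptic
  obtain ⟨m, hm⟩ := hgen P₁
  obtain ⟨m', hm'⟩ := hgen₁ P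
  -- `(1 − m' m) • P` is torsion, hence `m' m = 1`
  have htor : IsOfFinAddOrder ((1 - m' * m) • QuadraticDescent.incl K B P) := by
    have e : (1 - m' * m) • QuadraticDescent.incl K B P =
        (QuadraticDescent.incl K B P - m' • QuadraticDescent.incl K B P₁) +
          m' • (QuadraticDescent.incl K B P₁ - m • QuadraticDescent.incl K B P) := by module
    rw [e]; exact hm'.add hm.zsmul
  have hmm : m' * m = 1 := by
    by_contra hne
    have h1 : (1 - m' * m) ≠ 0 := sub_ne_zero.mpr (Ne.symm hne)
    obtain ⟨N, hN0, hN⟩ := (isOfFinAddOrder_iff_zsmul_eq_zero).mp htor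
    exact hP (isOfFinAddOrder_iff_zsmul_eq_zero.mpr ⟨N * (1 - m' * m), mul_ne_zero hN0 h1, by rw [mul_smul, hN]⟩)
  have hm1 : m = 1 ∨ m = -1 := by
    rcases Int.mul_eq_one_iff_eq_one_or_neg_one.mp hmm with ⟨-, h⟩ | ⟨-, h⟩
    · exact Or.inl h
    · exact Or.inr h
  have e : QuadraticDescent.incl K B P₁ =
      m • QuadraticDescent.incl K B P + (QuadraticDescent.incl K B P₁ - m • QuadraticDescent.incl K B P) := by abel
  rw [e, canonicalHeight_add_of_isOfFinAddOrder _ _ hm, canonicalHeight_zsmul_holds]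
  rcases hm1 with rfl | rfl <;> simp

/-- **The `2`-adic count**: `4^e · N · n₁² = 4^{e₁} · N₁ · n²` with `N, N₁, n, n₁` odd forces `e = e₁`. [folklore] -/
theorem two_pow_exponent_eq {e e₁ : ℕ} {N N₁ n n₁ : ℤ} (hN : Odd N) (hN₁ : Odd N₁) (hn : Odd n) (hn₁ : Odd n₁)
    (h : (4 : ℤ) ^ e * N * n₁ ^ 2 = (4 : ℤ) ^ e₁ * N₁ * n ^ 2) : e = e₁ := by
  -- the odd parts
  have hL : Odd (N * n₁ ^ 2) := hN.mul hn₁.pow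
  have hR : Odd (N₁ * n ^ 2) := hN₁.mul hn.pow
  by_contra hne
  rcases Nat.lt_or_gt_of_ne hne with hlt | hgt
  · -- cancel `4^e`: the left odd part equals `4^{e₁ - e} · (odd)`, even
    obtain ⟨d, hd⟩ := Nat.exists_eq_add_of_lt hlt
    have h' : N * n₁ ^ 2 = 4 ^ (d + 1) * (N₁ * n ^ 2) := by
      have h4 : (4 : ℤ) ^ e ≠ 0 := pow_ne_zero _ (by norm_num)
      apply mul_left_cancel₀ h4
      rw [hd, show e + d + 1 = e + (d + 1) by ring, pow_add] at h
      linear_combination h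
    have heven : Even (N * n₁ ^ 2) := by
      rw [h', pow_succ']
      exact (Int.even_mul.mpr (Or.inl (by decide : Even (4 : ℤ)))).mul_right _
    exact (Int.not_even_iff_odd.mpr hL) heven
  · obtain ⟨d, hd⟩ := Nat.exists_eq_add_of_lt hgt
    have h' : N₁ * n ^ 2 = 4 ^ (d + 1) * (N * n₁ ^ 2) := by
      have h4 : (4 : ℤ) ^ e₁ ≠ 0 := pow_ne_zero _ (by norm_num)
      apply mul_left_cancel₀ h4
      rw [hd, show e₁ + d + 1 = e₁ + (d + 1) by ring, pow_add] at h
      linear_combination -h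
    have heven : Even (N₁ * n ^ 2) := by
      rw [h', pow_succ']
      exact (Int.even_mul.mpr (Or.inl (by decide : Even (4 : ℤ)))).mul_right _
    exact (Int.not_even_iff_odd.mpr hR) heven

end Summit.BirchSwinnertonDyer.BirchSwinnertonDyer.Theorems.SylvesterTwoCoupledTelescope

end
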